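import Summits.Ventures.CertifiedArithmetic.LowPrec.GemmFirstRegimeGridLaw
import Summits.Ventures.CertifiedArithmetic.LowPrec.GemmFirstRegimeSpineBase
import HarnessLib

/-!
# GEMM worst case LXVIII-a — THE LEVEL-`2T` CLIMBING FAMILY, every precision and every grid alphabet

HONEST FRAMING (venture CertifiedArithmetic / cell `pub-lowprec`): certified error envelopes and
provably optimal rounding/accumulation schemes for low-precision formats under stated cost models;
every table by two implementations; no hardware or vendor claims.

Beyond the first regime.  The exact first-regime law (`relErr_le_firstRegimeLaw_all`, file LXIV-c;
rows `worstP_firstRegime`, `worstP_firstRegimeLaw_two/_one`) covers `k ≤ 2^(p-1) = T/2` letters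
after the exact range (`T = 2^(manBits+1)` in grid units `2^-G`).  This file exhibits, for EVERY
precision `p ≥ 2` and every grid alphabet `(G, M, m₀)` with `3 ≤ m₀`, the family that takes over
right after: the CLIMBING WORD

  `A, B, M^{×j}, C, 3^{×c}, 2, -2, -2, …`                                        (`cw`)

with `V = A + B + Mj + C ≡ 3 (mod 4)`, `T ≤ V < 2T` and `V + 4c = 2T + 3`.  Its trajectory is
explicit (`cw_seqSum_climb/_switch/_chain`): the entry `V` is odd on the binade of spacing `2`, a
midpoint whose EVEN neighbour is `V + 1 ≡ 0 (mod 4)` — the accumulator climbs ONE unit above the sum;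
each letter `3` lands on `≡ 3 (mod 4)` again and climbs one more unit (ties below `2T`, nearest on
the binade `[2T, 4T)` of spacing `4`), reaching `2T + 4` after `c` letters; the letter `2` gives
`2T + 6`, the midpoint of `2T + 4` and `2T + 8`, whose even neighbour (spacing-`8` multiple) is
`2T + 8`; and every `-2` gives `2T + 6 ↦ 2T + 8` again, forever.  Hence (`relErr_cw`)

  `R(cw, j + 3 + c + r) = (c + 3 + 2r) / (V + 3c + 2 + 2r)`,   every `r ≥ 0`,

increasing to `1`.  Three integer facts about round-to-nearest-even carry the whole computation
(`rneZ_up_of_mod4`: `K ≡ 3 (mod 4)`, `T ≤ K < 4T` ⟹ `rne(K) = K + 1`; `rneZ_absorb_two`: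
`8 ∣ K + 2`, `2T + 6 ≤ K`, `K + 2 ≤ 4T` ⟹ `rne(K) = K + 2`), both read off the binade lemma
`rneZ_level` of file LXIV-a.  File LXVIII-b instantiates the family for `Π(E2M1,E2M1)` at every
`p ≥ 8` (six residue classes of `p mod 6`), proves that it beats the first-regime closed form for
every `k ≥ 2^(p-1) + 2` (exceptional classes) / `2^(p-1) + 5` (the others) — the first regime ends
at `k = 2^(p-1)` up to at most four lengths, at every precision — and evaluates it for bfloat16 (the
level-7 family (a) of file LIII, consistency) and binary16 (`n ≥ 1044`: Prop. p:fp16's closed form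
fails; equality with the certified `W_11(1200) = 1857/4931`).

References: [IEEE7542019, §4.3.1] (ties-to-even), [Higham2002, §4.2] (recursive summation model),
[BoldoEtAl2023, Thm 4.5] and [LangeRump2019] (the first-regime value `ku/(1+ku)` this family
overtakes), cell documents `GEMM-BOUNDS.md` §4 (certified rows) and `gemm.tex` Prop. p:level2T.
-/

namespace Summit.Ventures.CertifiedArithmetic.LowPrec.Gemm

open Literature.ComputerArithmetic.FloatingPoint
open Literature.ComputerArithmetic.FloatingPoint.MiniFloat
open Finset

/-! ### Two integer rounding facts on the binades `[T, 2T)` and `[2T, 4T)` -/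

/-- CLIMBING STEP: for `T ≤ K < 4T` with `K ≡ 3 (mod 4)`, round-to-nearest-even gives `K + 1` — below
`2T` (spacing `2`) `K` is a midpoint and its even neighbour is the multiple of `4`, on `[2T, 4T)`
(spacing `4`) `K + 1` is the nearest multiple of `4`. [cite: IEEE7542019, §4.3.1] -/
theorem rneZ_up_of_mod4 {m K : ℕ} (hlo : 2 ^ (m + 1) ≤ K) (hhi : K < 4 * 2 ^ (m + 1))
    (hK : K % 4 = 3) : rneZ m (K : ℤ) = (K : ℤ) + 1 := by
  by_cases hlt : K < 2 * 2 ^ (m + 1)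
  · obtain ⟨-, h2, h3, h4, -, -⟩ := rneZ_level (m := m) (e := 0) (K := (K : ℤ))
      (by rw [Int.natAbs_natCast, show m + 0 + 1 = m + 1 by ring]; exact hlo)
      (by rw [Int.natAbs_natCast, show 2 ^ (m + 0 + 2) = 2 * 2 ^ (m + 1) by ring]; exact hlt)
    have e2 : (2 : ℤ) ^ (0 + 1) = 2 := by norm_num
    have e4 : (2 : ℤ) ^ (0 + 2) = 4 := by norm_num
    rw [e2] at h2
    rw [pow_zero] at h3 h4
    rw [e4] at h4
    have hne : (rneZ m (K : ℤ) - (K : ℤ)).natAbs = 1 := by omega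
    have h8 := h4 hne
    omega
  · obtain ⟨-, h2, h3, -, -, -⟩ := rneZ_level (m := m) (e := 1) (K := (K : ℤ))
      (by rw [Int.natAbs_natCast, show 2 ^ (m + 1 + 1) = 2 * 2 ^ (m + 1) by ring]; omega)
      (by rw [Int.natAbs_natCast, show 2 ^ (m + 1 + 2) = 4 * 2 ^ (m + 1) by ring]; exact hhi)
    have e4 : (2 : ℤ) ^ (1 + 1) = 4 := by norm_num
    rw [e4] at h2
    rw [pow_one] at h3
    omega

/-- ABSORBED STEP: for `2T + 6 ≤ K`, `K + 2 ≤ 4T` and `8 ∣ K + 2`, round-to-nearest-even gives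
`K + 2` — `K` is the midpoint of the spacing-`4` neighbours `K - 2`, `K + 2` and the even one is the
multiple of `8`.  (With `K = W - 2`: every multiple `W` of `8` in `[2T + 8, 4T]` absorbs a letter
`-2`.) [cite: IEEE7542019, §4.3.1] -/
theorem rneZ_absorb_two {m K : ℕ} (hlo : 2 * 2 ^ (m + 1) + 6 ≤ K) (hhi : K + 2 ≤ 4 * 2 ^ (m + 1))
    (h8 : 8 ∣ K + 2) : rneZ m (K : ℤ) = (K : ℤ) + 2 := by
  obtain ⟨-, h2, h3, h4, -, -⟩ := rneZ_level (m := m) (e := 1) (K := (K : ℤ))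
    (by rw [Int.natAbs_natCast, show 2 ^ (m + 1 + 1) = 2 * 2 ^ (m + 1) by ring]; omega)
    (by rw [Int.natAbs_natCast, show 2 ^ (m + 1 + 2) = 4 * 2 ^ (m + 1) by ring]; omega)
  have e4 : (2 : ℤ) ^ (1 + 1) = 4 := by norm_num
  have e8 : (2 : ℤ) ^ (1 + 2) = 8 := by norm_num
  rw [e4] at h2
  rw [pow_one] at h3 h4
  rw [e8] at h4
  have hne : (rneZ m (K : ℤ) - (K : ℤ)).natAbs = 2 := by omega
  have h16 := h4 hne
  omega

/-! ### The climbing word `A, B, M^{×j}, C, 3^{×c}, 2, -2, -2, …` in grid units -/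

/-- The climbing word in grid units. [cell, gemm.tex Prop. p:level2T] -/
def cwZ (M j A B C c : ℕ) (i : ℕ) : ℤ :=
  if i = 0 then A else if i = 1 then B else if i ≤ j + 1 then M else if i = j + 2 then C
  else if i ≤ j + 2 + c then 3 else if i = j + 3 + c then 2 else -2

/-- The climbing word in value units (grid `2^-G`). [cell] -/
def cw (G M j A B C c : ℕ) : ℕ → ℚ := fun i => (cwZ M j A B C c i : ℚ) / 2 ^ G

variable {G M m0 j A B C c : ℕ}

/-- Letter `0` is `A`. [cell] -/
theorem cwZ_zero : cwZ M j A B C c 0 = A := by unfold cwZ; rw [if_pos rfl]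

/-- Letter `1` is `B`. [cell] -/
theorem cwZ_one : cwZ M j A B C c 1 = B := by unfold cwZ; rw [if_neg one_ne_zero, if_pos rfl]

/-- Letters `2 … j+1` are `M`. [cell] -/
theorem cwZ_mid {i : ℕ} (h2 : 2 ≤ i) (h : i ≤ j + 1) : cwZ M j A B C c i = M := by
  unfold cwZ; rw [if_neg (by omega), if_neg (by omega), if_pos h]

/-- Letter `j+2` (the entry letter) is `C`. [cell] -/
theorem cwZ_entry : cwZ M j A B C c (j + 2) = C := by
  unfold cwZ; rw [if_neg (by omega), if_neg (by omega), if_neg (by omega), if_pos rfl]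

/-- Letters `j+3 … j+2+c` (the climb) are `3`. [cell] -/
theorem cwZ_climb {i : ℕ} (h1 : j + 2 < i) (h2 : i ≤ j + 2 + c) : cwZ M j A B C c i = 3 := by
  unfold cwZ
  rw [if_neg (by omega), if_neg (by omega), if_neg (by omega), if_neg (by omega), if_pos h2]

/-- Letter `j+3+c` (the switch) is `2`. [cell] -/
theorem cwZ_switch : cwZ M j A B C c (j + 3 + c) = 2 := by
  unfold cwZ
  rw [if_neg (by omega), if_neg (by omega), if_neg (by omega), if_neg (by omega), if_neg (by omega),
    if_pos rfl]

/-- Letters after `j+3+c` (the chain) are `-2`. [cell] -/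
theorem cwZ_chain {i : ℕ} (h : j + 3 + c < i) : cwZ M j A B C c i = -2 := by
  unfold cwZ
  rw [if_neg (by omega), if_neg (by omega), if_neg (by omega), if_neg (by omega), if_neg (by omega),
    if_neg (by omega)]

/-- Letters up to the switch are nonnegative. [cell] -/
theorem cwZ_nonneg {i : ℕ} (h : i ≤ j + 3 + c) : 0 ≤ cwZ M j A B C c i := by
  unfold cwZ
  split_ifs <;> first | positivity | omega

/-- Every letter satisfies a property that `A, B, M, C, 3, 2, -2` satisfy. [cell] -/
theorem cwZ_forall {P : ℤ → Prop} (hA : P A) (hB : P B) (hM : P M) (hC : P C) (h3 : P 3)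
    (h2 : P 2) (hn2 : P (-2)) (i : ℕ) : P (cwZ M j A B C c i) := by
  unfold cwZ; split_ifs <;> assumption

/-- … in value units (used with `P = (· ∈ Π)` per alphabet). [cell] -/
theorem cw_forall {P : ℚ → Prop} (hA : P ((A : ℚ) / 2 ^ G)) (hB : P ((B : ℚ) / 2 ^ G))
    (hM : P ((M : ℚ) / 2 ^ G)) (hC : P ((C : ℚ) / 2 ^ G)) (h3 : P (3 / 2 ^ G))
    (h2 : P (2 / 2 ^ G)) (hn2 : P (-2 / 2 ^ G)) (i : ℕ) : P (cw G M j A B C c i) := by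
  unfold cw
  refine cwZ_forall (P := fun z : ℤ => P ((z : ℚ) / 2 ^ G)) ?_ ?_ ?_ ?_ ?_ ?_ ?_ i <;>
    push_cast <;> assumption

/-- A natural letter's integer facts. [cell] -/
theorem letterZ_of_nat {X : ℕ} (hX : X ≤ M ∧ (X % 2 = 0 ∨ X ≤ m0)) :
    ((X : ℤ)).natAbs ≤ M ∧ ((X : ℤ) % 2 = 0 ∨ ((X : ℤ)).natAbs ≤ m0) := by
  rw [Int.natAbs_natCast]
  refine ⟨hX.1, ?_⟩
  rcases hX.2 with h | h
  · left; omega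
  · exact Or.inr h

/-- The climbing word is a word over the grid alphabet `(G, M, m₀)` when `A, B, C` are letters, `M`
is even and `3 ≤ m₀ ≤ M`. [cell] -/
theorem cw_facts (hA : A ≤ M ∧ (A % 2 = 0 ∨ A ≤ m0)) (hB : B ≤ M ∧ (B % 2 = 0 ∨ B ≤ m0))
    (hC : C ≤ M ∧ (C % 2 = 0 ∨ C ≤ m0)) (hMev : M % 2 = 0) (hm0 : 3 ≤ m0) (hm0M : m0 ≤ M)
    (i : ℕ) : ∃ z : ℤ, cw G M j A B C c i = (z : ℚ) / 2 ^ G ∧ z.natAbs ≤ M ∧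
      (z % 2 = 0 ∨ z.natAbs ≤ m0) := by
  refine ⟨cwZ M j A B C c i, rfl, ?_⟩
  refine cwZ_forall (P := fun z : ℤ => z.natAbs ≤ M ∧ (z % 2 = 0 ∨ z.natAbs ≤ m0))
    (letterZ_of_nat hA) (letterZ_of_nat hB) (letterZ_of_nat ⟨le_rfl, Or.inl hMev⟩)
    (letterZ_of_nat hC) ⟨by omega, Or.inr (by omega)⟩ ⟨by omega, Or.inl (by decide)⟩
    ⟨by omega, Or.inl (by decide)⟩ i

/-! ### Masses -/

/-- Mass at the entry: `Σ_{i ≤ j+2} = A + B + Mj + C`. [cell] -/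
theorem cwZ_sum_entry : ∑ i ∈ range (j + 3), cwZ M j A B C c i = ((A + B + M * j + C : ℕ) : ℤ) := by
  have h : ∑ i ∈ range j, cwZ M j A B C c (i + 1 + 1) = ∑ _i ∈ range j, (M : ℤ) :=
    sum_congr rfl fun i hi => cwZ_mid (by omega) (by have := mem_range.mp hi; omega)
  rw [show j + 3 = (j + 1 + 1) + 1 by ring, sum_range_succ, sum_range_succ', sum_range_succ',
    cwZ_zero, Nat.zero_add, cwZ_one, h, sum_const, card_range, nsmul_eq_mul]
  have e : cwZ M j A B C c (j + 1 + 1) = C := cwZ_entry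
  rw [e]
  push_cast; ring

/-- Mass along the climb: `Σ_{i ≤ j+2+t} = A + B + Mj + C + 3t` (`t ≤ c`). [cell] -/
theorem cwZ_sum_climb : ∀ t ≤ c,
    ∑ i ∈ range (j + 3 + t), cwZ M j A B C c i = ((A + B + M * j + C + 3 * t : ℕ) : ℤ)
  | 0, _ => by rw [Nat.add_zero, Nat.mul_zero, Nat.add_zero]; exact cwZ_sum_entry
  | t + 1, ht => by
      rw [show j + 3 + (t + 1) = (j + 3 + t) + 1 by ring, sum_range_succ, cwZ_sum_climb t (by omega),
        cwZ_climb (by omega) (by omega)]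
      push_cast; ring

/-- Mass along the chain: `Σ_{i ≤ j+3+c+r} = A + B + Mj + C + 3c + 2 - 2r`. [cell] -/
theorem cwZ_sum_chain : ∀ r : ℕ, ∑ i ∈ range (j + 3 + c + r + 1), cwZ M j A B C c i
      = ((A + B + M * j + C + 3 * c + 2 : ℕ) : ℤ) - 2 * r
  | 0 => by
      rw [show j + 3 + c + 0 + 1 = (j + 3 + c) + 1 by ring, sum_range_succ, cwZ_sum_climb c le_rfl,
        cwZ_switch]
      push_cast; ring
  | r + 1 => by
      rw [show j + 3 + c + (r + 1) + 1 = (j + 3 + c + r + 1) + 1 by ring, sum_range_succ,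
        cwZ_sum_chain r, cwZ_chain (by omega)]
      push_cast; ring

/-- Mass of moduli along the chain: `Σ_{i ≤ j+3+c+r} |·| = A + B + Mj + C + 3c + 2 + 2r`. [cell] -/
theorem cwZ_absSum_chain : ∀ r : ℕ, ∑ i ∈ range (j + 3 + c + r + 1), |cwZ M j A B C c i|
      = ((A + B + M * j + C + 3 * c + 2 + 2 * r : ℕ) : ℤ)
  | 0 => by
      rw [sum_congr rfl fun i hi => abs_of_nonneg
        (cwZ_nonneg (M := M) (A := A) (B := B) (C := C) (by have := mem_range.mp hi; omega)),
        cwZ_sum_chain 0]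
      push_cast; ring
  | r + 1 => by
      rw [show j + 3 + c + (r + 1) + 1 = (j + 3 + c + r + 1) + 1 by ring, sum_range_succ,
        cwZ_absSum_chain r, cwZ_chain (by omega)]
      push_cast; norm_num; ring

/-- Sums of the word in value units are the integer sums over `2^G`. [cell] -/
theorem cw_sum (n : ℕ) :
    ∑ i ∈ range n, cw G M j A B C c i = ((∑ i ∈ range n, cwZ M j A B C c i : ℤ) : ℚ) / 2 ^ G := by
  unfold cw; simp only [div_eq_mul_inv]; rw [← Finset.sum_mul, Int.cast_sum]

/-- … and so are sums of moduli. [cell] -/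
theorem cw_absSum (n : ℕ) : ∑ i ∈ range n, |cw G M j A B C c i|
    = ((∑ i ∈ range n, |cwZ M j A B C c i| : ℤ) : ℚ) / 2 ^ G := by
  unfold cw
  rw [sum_congr rfl fun i _ =>
    (by rw [abs_div, abs_of_pos (by positivity : (0 : ℚ) < 2 ^ G), ← Int.cast_abs] :
      |(cwZ M j A B C c i : ℚ) / 2 ^ G| = ((|cwZ M j A B C c i| : ℤ) : ℚ) / 2 ^ G)]
  simp only [div_eq_mul_inv]; rw [← Finset.sum_mul, Int.cast_sum]

/-! ### The trajectory: climb to `2T + 4`, switch to `2T + 8`, absorb every `-2` -/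

variable {φ : Format} {E : ℕ}

section Bridge

variable (hq : φ.qexp ≤ -(G : ℤ)) (hR : (2 : ℚ) ^ (φ.manBits + E + 3) ≤ φ.maxRat)
include hq hR

/-- The bridge for natural grid numerators below `4T`: `fl_φ(K/2^G) = rne(K)/2^G`. [folklore] -/
theorem roundNE_gridNat {K : ℕ} (hK : K < 4 * 2 ^ (φ.manBits + 1)) :
    (roundNE φ ((K : ℚ) / 2 ^ G)).toRat = (rneZ φ.manBits K : ℚ) / 2 ^ G := by
  have hR' : (2 : ℚ) ^ (φ.manBits + (E + 3)) ≤ φ.maxRat := by rwa [← add_assoc]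
  have hK' : ((K : ℕ) : ℤ).natAbs < 2 ^ (φ.manBits + (E + 3) + G) := by
    rw [Int.natAbs_natCast]
    have h3 : 2 ^ (φ.manBits + 3) ≤ 2 ^ (φ.manBits + (E + 3) + G) :=
      Nat.pow_le_pow_right (by norm_num) (by omega)
    have e3 : 2 ^ (φ.manBits + 3) = 4 * 2 ^ (φ.manBits + 1) := by ring
    omega
  have hbr := toRat_roundNE_grid_prec hq ((K : ℕ) : ℤ) (grid_le_maxRat_of_lt hR' hK')
  rw [Int.cast_natCast] at hbr
  exact hbr

variable (hm0M : m0 ≤ M) (hMT : M ≤ 2 ^ (φ.manBits + 1)) (hm0 : 3 ≤ m0) (hMev : M % 2 = 0)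
include hm0M hMT hm0 hMev

/-- ENTRY: with `A, B, C` letters, `M(j+1) + m₀ < T` and `V = A + B + Mj + C ≡ 3 (mod 4)` in
`[T, 4T)`, the accumulator after the entry letter holds `V + 1` (below `2T` a tie resolved upward to
the multiple of `4`, above `2T` the nearest multiple of `4`). [cell, gemm.tex Prop. p:level2T] -/
theorem cw_seqSum_entry {V : ℕ} (hA : A ≤ M ∧ (A % 2 = 0 ∨ A ≤ m0))
    (hB : B ≤ M ∧ (B % 2 = 0 ∨ B ≤ m0)) (hC : C ≤ M ∧ (C % 2 = 0 ∨ C ≤ m0))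
    (hj : M * (j + 1) + m0 < 2 ^ (φ.manBits + 1)) (hV : A + B + M * j + C = V)
    (hTV : 2 ^ (φ.manBits + 1) ≤ V) (hV2 : V < 4 * 2 ^ (φ.manBits + 1)) (hV4 : V % 4 = 3) :
    (seqSum φ (cw G M j A B C c) (j + 2)).toRat = ((V + 1 : ℕ) : ℚ) / 2 ^ G := by
  have hx := cw_facts (G := G) (j := j) (c := c) hA hB hC hMev hm0 hm0M
  have hstep : seqSum φ (cw G M j A B C c) (j + 2)
      = roundNE φ ((seqSum φ (cw G M j A B C c) (j + 1)).toRat + cw G M j A B C c (j + 2)) := rfl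
  have harg : (seqSum φ (cw G M j A B C c) (j + 1)).toRat + cw G M j A B C c (j + 2)
      = ((V : ℕ) : ℚ) / 2 ^ G := by
    rw [seqSum_exact_prefixG hx hq hR hm0M hMT hj (j + 1) le_rfl]
    have h3 := cw_sum (G := G) (M := M) (j := j) (A := A) (B := B) (C := C) (c := c) (j + 3)
    rw [cwZ_sum_entry, hV, Int.cast_natCast, sum_range_succ] at h3
    exact h3
  rw [hstep, harg, roundNE_gridNat hq hR (K := V) hV2, rneZ_up_of_mod4 hTV hV2 hV4]
  push_cast; ring

/-- CLIMB: after `t ≤ c` letters `3` the accumulator holds `V + 1 + 4t` (`V + 4c ≤ 2T + 3`): each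
step lands on `≡ 3 (mod 4)` and is rounded up by one unit. [cell, gemm.tex Prop. p:level2T] -/
theorem cw_seqSum_climb {V : ℕ} (hA : A ≤ M ∧ (A % 2 = 0 ∨ A ≤ m0))
    (hB : B ≤ M ∧ (B % 2 = 0 ∨ B ≤ m0)) (hC : C ≤ M ∧ (C % 2 = 0 ∨ C ≤ m0))
    (hj : M * (j + 1) + m0 < 2 ^ (φ.manBits + 1)) (hV : A + B + M * j + C = V)
    (hTV : 2 ^ (φ.manBits + 1) ≤ V) (hV4 : V % 4 = 3)
    (hc : V + 4 * c ≤ 2 * 2 ^ (φ.manBits + 1) + 3) :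
    ∀ t ≤ c, (seqSum φ (cw G M j A B C c) (j + 2 + t)).toRat = ((V + 1 + 4 * t : ℕ) : ℚ) / 2 ^ G
  | 0, _ => by
      rw [Nat.mul_zero, Nat.add_zero, Nat.add_zero]
      have hT1 : 1 ≤ 2 ^ (φ.manBits + 1) := Nat.one_le_two_pow
      exact cw_seqSum_entry hq hR hm0M hMT hm0 hMev hA hB hC hj hV hTV (by omega) hV4
  | t + 1, ht => by
      rw [show j + 2 + (t + 1) = (j + 2 + t) + 1 by ring]
      simp only [seqSum]
      rw [cw_seqSum_climb hA hB hC hj hV hTV hV4 hc t (by omega)]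
      have hlet : cw G M j A B C c (j + 2 + t + 1) = 3 / 2 ^ G := by
        unfold cw; rw [cwZ_climb (by omega) (by omega)]; push_cast; ring
      rw [hlet, show ((V + 1 + 4 * t : ℕ) : ℚ) / 2 ^ G + 3 / 2 ^ G
          = (((V + 4 * t + 4 : ℕ) : ℚ)) / 2 ^ G by push_cast; ring,
        roundNE_gridNat hq hR (K := V + 4 * t + 4) (by omega),
        rneZ_up_of_mod4 (K := V + 4 * t + 4) (by omega) (by omega) (by omega)]
      push_cast; ring

/-- SWITCH: with `V + 4c = 2T + 3` the climb ends at `2T + 4` and the letter `2` gives `2T + 6`,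
a midpoint of the spacing-`4` binade resolved to the multiple of `8`: the accumulator holds `2T + 8`.
[cell, gemm.tex Prop. p:level2T] -/
theorem cw_seqSum_switch {V : ℕ} (hA : A ≤ M ∧ (A % 2 = 0 ∨ A ≤ m0))
    (hB : B ≤ M ∧ (B % 2 = 0 ∨ B ≤ m0)) (hC : C ≤ M ∧ (C % 2 = 0 ∨ C ≤ m0))
    (hj : M * (j + 1) + m0 < 2 ^ (φ.manBits + 1)) (hV : A + B + M * j + C = V)
    (hTV : 2 ^ (φ.manBits + 1) ≤ V) (hV4 : V % 4 = 3)
    (hc : V + 4 * c = 2 * 2 ^ (φ.manBits + 1) + 3) :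
    (seqSum φ (cw G M j A B C c) (j + 3 + c)).toRat
      = ((2 * 2 ^ (φ.manBits + 1) + 8 : ℕ) : ℚ) / 2 ^ G := by
  have hmb : 1 ≤ φ.manBits := one_le_manBits_of hm0M (by omega) hj
  have h4T : 4 ∣ 2 ^ (φ.manBits + 1) := ⟨2 ^ (φ.manBits - 1), by
    rw [show (4 : ℕ) = 2 ^ 2 by norm_num, ← pow_add]; congr 1; omega⟩
  have hT4 : 4 ≤ 2 ^ (φ.manBits + 1) := Nat.le_of_dvd (by positivity) h4T
  rw [show j + 3 + c = (j + 2 + c) + 1 by ring]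
  simp only [seqSum]
  rw [cw_seqSum_climb hq hR hm0M hMT hm0 hMev hA hB hC hj hV hTV hV4 hc.le c le_rfl]
  have hlet : cw G M j A B C c (j + 2 + c + 1) = 2 / 2 ^ G := by
    unfold cw; rw [show j + 2 + c + 1 = j + 3 + c by ring, cwZ_switch]; push_cast; ring
  have e1 : ((V + 1 + 4 * c : ℕ) : ℚ) / 2 ^ G + 2 / 2 ^ G
      = (((2 * 2 ^ (φ.manBits + 1) + 6 : ℕ) : ℚ)) / 2 ^ G := by
    rw [show 2 * 2 ^ (φ.manBits + 1) + 6 = V + 1 + 4 * c + 2 by omega]; push_cast; ring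
  rw [hlet, e1, roundNE_gridNat hq hR (K := 2 * 2 ^ (φ.manBits + 1) + 6) (by omega),
    rneZ_absorb_two (K := 2 * 2 ^ (φ.manBits + 1) + 6) le_rfl (by omega) (by omega)]
  push_cast; ring

/-- CHAIN: every later letter `-2` is absorbed (`2T + 8 - 2 = 2T + 6 ↦ 2T + 8`): the accumulator holds
`2T + 8` after `j + 4 + c + r` letters, every `r`. [cell, gemm.tex Prop. p:level2T] -/
theorem cw_seqSum_chain {V : ℕ} (hA : A ≤ M ∧ (A % 2 = 0 ∨ A ≤ m0))
    (hB : B ≤ M ∧ (B % 2 = 0 ∨ B ≤ m0)) (hC : C ≤ M ∧ (C % 2 = 0 ∨ C ≤ m0))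
    (hj : M * (j + 1) + m0 < 2 ^ (φ.manBits + 1)) (hV : A + B + M * j + C = V)
    (hTV : 2 ^ (φ.manBits + 1) ≤ V) (hV4 : V % 4 = 3)
    (hc : V + 4 * c = 2 * 2 ^ (φ.manBits + 1) + 3) :
    ∀ r : ℕ, (seqSum φ (cw G M j A B C c) (j + 3 + c + r)).toRat
      = ((2 * 2 ^ (φ.manBits + 1) + 8 : ℕ) : ℚ) / 2 ^ G
  | 0 => by
      rw [Nat.add_zero]
      exact cw_seqSum_switch hq hR hm0M hMT hm0 hMev hA hB hC hj hV hTV hV4 hc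
  | r + 1 => by
      have hmb : 1 ≤ φ.manBits := one_le_manBits_of hm0M (by omega) hj
      have h4T : 4 ∣ 2 ^ (φ.manBits + 1) := ⟨2 ^ (φ.manBits - 1), by
        rw [show (4 : ℕ) = 2 ^ 2 by norm_num, ← pow_add]; congr 1; omega⟩
      have hT4 : 4 ≤ 2 ^ (φ.manBits + 1) := Nat.le_of_dvd (by positivity) h4T
      rw [show j + 3 + c + (r + 1) = (j + 3 + c + r) + 1 by ring]
      simp only [seqSum]
      rw [cw_seqSum_chain hA hB hC hj hV hTV hV4 hc r]
      have hlet : cw G M j A B C c (j + 3 + c + r + 1) = -2 / 2 ^ G := by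
        unfold cw; rw [cwZ_chain (by omega)]; push_cast; ring
      have e1 : ((2 * 2 ^ (φ.manBits + 1) + 8 : ℕ) : ℚ) / 2 ^ G + -2 / 2 ^ G
          = (((2 * 2 ^ (φ.manBits + 1) + 6 : ℕ) : ℚ)) / 2 ^ G := by
        push_cast; ring
      rw [hlet, e1, roundNE_gridNat hq hR (K := 2 * 2 ^ (φ.manBits + 1) + 6) (by omega),
        rneZ_absorb_two (K := 2 * 2 ^ (φ.manBits + 1) + 6) le_rfl (by omega) (by omega)]
      push_cast; ring

/-- THE RELATIVE ERROR OF THE CLIMBING FAMILY, every precision and every grid alphabet: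
`R(cw, j + 3 + c + r) = (c + 3 + 2r)/(V + 3c + 2 + 2r)` for every `r ≥ 0` (computed `2T + 8`, exact
`V + 3c + 2 - 2r`, mass `V + 3c + 2 + 2r`; `2T + 3 = V + 4c`). [cell, gemm.tex Prop. p:level2T] -/
theorem relErr_cw {V : ℕ} (hA : A ≤ M ∧ (A % 2 = 0 ∨ A ≤ m0))
    (hB : B ≤ M ∧ (B % 2 = 0 ∨ B ≤ m0)) (hC : C ≤ M ∧ (C % 2 = 0 ∨ C ≤ m0))
    (hj : M * (j + 1) + m0 < 2 ^ (φ.manBits + 1)) (hV : A + B + M * j + C = V)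
    (hTV : 2 ^ (φ.manBits + 1) ≤ V) (hV4 : V % 4 = 3)
    (hc : V + 4 * c = 2 * 2 ^ (φ.manBits + 1) + 3) (r : ℕ) :
    relErr φ (cw G M j A B C c) (j + 3 + c + r)
      = ((c + 3 + 2 * r : ℕ) : ℚ) / ((V + 3 * c + 2 + 2 * r : ℕ) : ℚ) := by
  unfold relErr
  rw [cw_seqSum_chain hq hR hm0M hMT hm0 hMev hA hB hC hj hV hTV hV4 hc r, cw_sum, cw_absSum,
    cwZ_sum_chain, cwZ_absSum_chain, hV, ← sub_div]
  have key : ((2 * 2 ^ (φ.manBits + 1) + 8 : ℕ) : ℚ) - (((((V + 3 * c + 2 : ℕ) : ℤ) - 2 * r : ℤ)) : ℚ)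
      = ((c + 3 + 2 * r : ℕ) : ℚ) := by
    rw [show 2 * 2 ^ (φ.manBits + 1) + 8 = V + 3 * c + 2 + (c + 3) by omega]; push_cast; ring
  rw [key, abs_of_nonneg (by positivity), Int.cast_natCast,
    div_div_div_cancel_right₀ (by positivity : (2 : ℚ) ^ G ≠ 0)]

end Bridge

end Summit.Ventures.CertifiedArithmetic.LowPrec.Gemm
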